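import Summits.BirchSwinnertonDyer.BirchSwinnertonDyer.Theorems.KolyvaginDepthDoorKNSupplyResidualStructureOfPrint
import Summits.BirchSwinnertonDyer.BirchSwinnertonDyer.Theorems.KolyvaginDepthDoorKNSupplyResidualStructureSplit
import HarnessLib

/-!
# Route `KolyvaginDepthDoor`, crux `KolyvaginDepthSupplyKN` (stmt-BirchSwinnertonDyer-22820) —
# THE COMPOSITION OF SKELETON v7 OF LINE `levelone` (residual structure stub discharged modulo print
# + a `p`-optimal frame)

Helper file of the lead prover of line `levelone` (kdd-p1 g13; `--supports stmt-BirchSwinnertonDyer-22820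
--as helper`); it closes nothing and BSD is not proved by it.

Skeleton v6 (g12) consumed, on the ♠ (2)-residual class at analytic rank `≥ 2`, the stub
`stub_modPStructureResidualRankTwo` — per `(E, p, K)` produced by the line, a level-one class
`c_1(n) ≠ 0`, `n ∈ Λ`, with `#Sel_p(E/ℚ) = p^{ν(n)+1} ∨ #Sel_p(E^{(d_K)}/ℚ) = p^{ν(n)+1}` — "open as
typed, print untyped". With the named fact
`Literature.NumberTheory.EllipticCurves.HowardZanarella_exists_minimal_kolyvaginClass_one_selmerCard_of_ne_zero`
(Howard 2004 / Zanarella 2019 mod-`p` rigidity, filed by this seat, p675362) the print is now typed, and: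

* (sibling file `KolyvaginDepthDoorKNSupplyResidualStructureOfPrint`) `modPStructureResidualRankTwo_of_print`
  — the residual stub's signature VERBATIM from BCGS Thm. 2, Zanarella Prop. 2.18, the Howard–Zanarella
  rigidity fact, modularity and the `p`-optimal frame `hOpt` (print bookkeeping, open as typed).
* `kolyvaginDepthSupplyKN_of_hypotheses_print` — COMPOSITION OF SKELETON v7: the crux BY NAME from
  (1′) «`Ш(E)[p] = 0` eventually» at analytic rank `≥ 2` on non-CM curves (OPEN), the print facts of
  v6 (modularity ∧ HL ∧ BFH ∧ GZK; Gross–Zagier I.6.3; W. Zhang L8.4 (1)/9.1), the three residual print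
  facts (BCGS Thm. 2, Zanarella 2.18, Howard–Zanarella), and `hOpt` — i.e. v6's composition
  `kolyvaginDepthSupplyKN_of_hypotheses_residualStructureSplit` with its residual stub DISCHARGED.
* `kolyvaginDepthSupplyKN_of_shaFiniteConjecture_print` — the class-wide calibration, v7: Tate's
  `ShaFiniteConjecture` + print + `hOpt` ⟹ crux.

CONDITIONAL (named facts as hypotheses; `hOpt` open as typed); BSD is NOT proved by any of this.

References: [BurungaleEtAl2026] Thm. 2 and §1.2 (arXiv:2312.09301, held text p0010 L29–L32);
[Zanarella2019] Prop. 2.18, Cor. 2.12, 2.14, Prop. 2.15; [Howard2004] Thm. 1.4.2, Prop. 1.5.5,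
Lemma 1.6.4; [WZhang2014] Lemma 8.4 (1), Thm. 9.1; [SilvermanATAEC1994] Cor. IV.9.2 (d), Table 4.1
(`c_v` on the Kodaira–Néron cell); [Tate1974] Conj. 1.
-/

-- D-0017: single-problem summit, `Summit.BirchSwinnertonDyer.BirchSwinnertonDyer.…` repeats a namespace BY DESIGN.
set_option linter.dupNamespace false

noncomputable section

open scoped Classical NumberField

namespace Summit.BirchSwinnertonDyer.BirchSwinnertonDyer.Theorems.KolyvaginDepthDoor

open Literature.NumberTheory.EllipticCurves Literature.NumberTheory.EllipticCurves.ModularForms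
  WeierstrassCurve IsDedekindDomain
open Summit.BirchSwinnertonDyer.BirchSwinnertonDyer.Theorems
open Summit.BirchSwinnertonDyer.BirchSwinnertonDyer.Theses.KolyvaginDepthDoor

/-- **COMPOSITION OF SKELETON v7 (line `levelone`): `KolyvaginDepthSupplyKN` BY NAME** from
(1′) «`Ш(E)[p] = 0` for all large `p`» on non-CM curves of analytic rank `≥ 2` (OPEN — the only open
mathematics of the line), the PRINT facts (2) modularity ∧ Hoffstein–Luo ∧ BFH ∧ GZK, (2′) Gross–Zagier
I.6.3, (3) W. Zhang L8.4 (1)/9.1, (6a) BCGS Thm. 2 ∧ Zanarella Prop. 2.18 ∧ Howard–Zanarella rigidity,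
and (6b) the `p`-optimal frame `hOpt` (print bookkeeping, open as typed) — v6's composition
`kolyvaginDepthSupplyKN_of_hypotheses_residualStructureSplit` with the residual structure stub
DISCHARGED by `modPStructureResidualRankTwo_of_print`. `#print axioms` standard. CONDITIONAL; BSD is
not proved by it. [cite: WZhang2014, Lemma 8.4 (1), Thm. 9.1] [cite: BurungaleEtAl2026, Thm. 2]
[cite: Zanarella2019, Prop. 2.18, Cor. 2.14] [cite: Howard2004, Lemma 1.6.4] [cite: GrossZagier1986, Thm. I.6.3] -/
theorem kolyvaginDepthSupplyKN_of_hypotheses_print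
    (hSha : ∀ (W : WeierstrassCurve ℚ) [W.IsElliptic] [W.IsGloballyMinimal], ¬ W.HasCM →
      2 ≤ W.analyticRank →
      ∃ B : ℕ, ∀ (p : ℕ) [Fact p.Prime], B < p →
        (W.sha ⊓ AddSubgroup.torsionBy W.galH1 (p : ℤ) : AddSubgroup W.galH1) = ⊥)
    (hPrint : exists_isNewformOf ∧ HoffsteinLuo1997_exists_twist_L_one_ne_zero ∧
      bumpFriedbergHoffstein_exists_heegnerField_split_twist_simpleZero ∧
      rank_eq_analyticRank_of_analyticRank_le_one)
    (hGZ : ∀ (W : WeierstrassCurve ℚ) (N : ℕ) [NeZero N] (K : Type) [Field K] [NumberField K],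
      analyticRankEK_eq_one_iff_heegner_nonTorsion W N K)
    (hZh : Literature.NumberTheory.EllipticCurves.WZhang2014_lemma84_exists_minimal_kolyvaginClass_one_selmerCard)
    (hRes : BurungaleEtAl2026.thm2_kolyvaginClass_divisibility_eq_padicValNat_tamagawaProduct ∧
      Literature.NumberTheory.EllipticCurves.Zanarella2019_kolyvaginClass_one_ne_zero_of_not_divisible ∧
      Literature.NumberTheory.EllipticCurves.HowardZanarella_exists_minimal_kolyvaginClass_one_selmerCard_of_ne_zero)
    (hOpt : exists_isNewformOf →
      ∀ (W : WeierstrassCurve ℚ) [W.IsElliptic] [W.IsGloballyMinimal] (p : ℕ) [Fact p.Prime],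
        5 ≤ p → W.HasSurjectiveModNGaloisRep p → ∀ [NeZero (W.conductorNorm ℤ)],
          ∃ Dt : ModularParametrizationData W (W.conductorNorm ℤ), Dt.IsPOptimal p) :
    KolyvaginDepthSupplyKN :=
  kolyvaginDepthSupplyKN_of_hypotheses_residualStructureSplit hSha hPrint hGZ hZh
    (modPStructureResidualRankTwo_of_print hRes.1 hRes.2.1 hRes.2.2 hPrint.1 hOpt)

/-- **CLASS-WIDE CALIBRATION, v7.** `KolyvaginDepthSupplyKN` follows from Tate's `ShaFiniteConjecture`
(OPEN, by name; used at analytic rank `≥ 2` only), the nine print facts of the line, and the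
`p`-optimal frame `hOpt` (print bookkeeping). CONDITIONAL; nothing is discharged; BSD is not proved by
it. [cite: Tate1974, Conj. 1] [cite: WZhang2014, Lemma 8.4 (1), Thm. 9.1]
[cite: BurungaleEtAl2026, Thm. 2] [cite: Zanarella2019, Prop. 2.18] [cite: Howard2004, Lemma 1.6.4] -/
theorem kolyvaginDepthSupplyKN_of_shaFiniteConjecture_print (hfin : ShaFiniteConjecture)
    (hPrint : exists_isNewformOf ∧ HoffsteinLuo1997_exists_twist_L_one_ne_zero ∧
      bumpFriedbergHoffstein_exists_heegnerField_split_twist_simpleZero ∧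
      rank_eq_analyticRank_of_analyticRank_le_one)
    (hGZ : ∀ (W : WeierstrassCurve ℚ) (N : ℕ) [NeZero N] (K : Type) [Field K] [NumberField K],
      analyticRankEK_eq_one_iff_heegner_nonTorsion W N K)
    (hZh : Literature.NumberTheory.EllipticCurves.WZhang2014_lemma84_exists_minimal_kolyvaginClass_one_selmerCard)
    (hRes : BurungaleEtAl2026.thm2_kolyvaginClass_divisibility_eq_padicValNat_tamagawaProduct ∧
      Literature.NumberTheory.EllipticCurves.Zanarella2019_kolyvaginClass_one_ne_zero_of_not_divisible ∧
      Literature.NumberTheory.EllipticCurves.HowardZanarella_exists_minimal_kolyvaginClass_one_selmerCard_of_ne_zero)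
    (hOpt : exists_isNewformOf →
      ∀ (W : WeierstrassCurve ℚ) [W.IsElliptic] [W.IsGloballyMinimal] (p : ℕ) [Fact p.Prime],
        5 ≤ p → W.HasSurjectiveModNGaloisRep p → ∀ [NeZero (W.conductorNorm ℤ)],
          ∃ Dt : ModularParametrizationData W (W.conductorNorm ℤ), Dt.IsPOptimal p) :
    KolyvaginDepthSupplyKN :=
  kolyvaginDepthSupplyKN_of_shaFiniteConjecture_residualStructureSplit hfin hPrint hGZ hZh
    (modPStructureResidualRankTwo_of_print hRes.1 hRes.2.1 hRes.2.2 hPrint.1 hOpt)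

end Summit.BirchSwinnertonDyer.BirchSwinnertonDyer.Theorems.KolyvaginDepthDoor

end
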